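import Summits.NavierStokesRegularity.NavierStokesRegularity.Theorems.ExtremiserTransienceTwoThirdsDefs
import Summits.NavierStokesRegularity.NavierStokesRegularity.Theorems.ExtremiserTransienceTwoThirdsThickGoodSet
import Summits.NavierStokesRegularity.NavierStokesRegularity.Theorems.ExtremiserTransienceTwoThirdsTranslateAverage
import HarnessLib

/-!
# Route `ExtremiserTransience`, crux `NearExtremalTransiencePerFlow` (stmt-NavierStokesRegularity-26567),
# LINE g10-1 «two_thirds» (ideator ns-idea-10 g10), stub S1a `TypicalSelection` — BRICK 4b: ASSEMBLY from per-scale uncovered bounds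

`--supports stmt-NavierStokesRegularity-26567` (helper; prover seat ns-net-p2 g12).  Reduces the conclusion of S1a (and of the proposed
large-scale repair S1a′) to PER-SCALE BOUNDS on the thick enstrophy of the UNCOVERED sets.  With `Θ = {‖curl v‖ ≥ θ₀M/λ}` (`θ₀ = κ⋆/4`),
candidate good-centre sets `G_i ⊆ {c : some r ∈ [4^i, 2·4^i] makes B(c, rλ) a good ball with tolerance K/(i+1)}` and the uncovered sets
`U_i = {y : no c ∈ G_i with dist c y < 4^iλ/2}` (closed, brick 4a `isClosed_uncovered`):

* `typicalSelection_of_uncovered_small` — if `∫_{Θ ∩ U_i} ‖curl v‖² ≤ β_i` for `i < m` and `Σ_{i<m} β_i < c₀·Z` (`c₀ = κ⋆/(4A₁)`), then a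
  THICK GOOD centre `x₀` exists which carries, at every scale `i < m`, a good ball `B(c, rλ)`, `r ∈ [4^i, 2·4^i]`, `dist c x₀ ≤ rλ/2` — i.e.
  the conclusion of `TypicalSelection` for this `v` (brick 1 `exists_thickGood_mem` applied to `Y = Θᶜ ∪ ⋂_{i<m} U_iᶜ`).

So S1a′ = brick 2 (localised sharp inequality ⇒ per-translate Chebyshev bound via `typicality_abstract`, brick 3a) + brick 4a (translate averaging
⇒ `∫_{Θ∩U_i}‖ω‖² ≤ β_i`) + this file.  HONEST FRAMING: bookkeeping over one admissible vector field; nothing about Navier–Stokes is proved; no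
summit is proved by a line. [folklore]
-/

noncomputable section

open scoped Topology InnerProductSpace RealInnerProductSpace ENNReal ContDiff
open MeasureTheory Filter Set Metric
open Literature.Analysis.FluidPDE
open Summit.NavierStokesRegularity.NavierStokesRegularity.Theorems.DepletionLadder
open Summit.NavierStokesRegularity.NavierStokesRegularity.Theorems.DepletionLadder.KStar.HalfSpace
open Summit.NavierStokesRegularity.NavierStokesRegularity.Theorems.DepletionLadder.KStar.BangBang
open Summit.NavierStokesRegularity.NavierStokesRegularity.Theorems.NearExtremalTransiencePerFlow.LocalMaximiser

namespace Summit.NavierStokesRegularity.NavierStokesRegularity.Theorems.NearExtremalTransiencePerFlow.TwoThirds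

-- the problem directory repeats the summit name (`NavierStokesRegularity/NavierStokesRegularity`)
set_option linter.dupNamespace false
set_option linter.style.longLine false

/-- Integral of a non-negative integrable function over a finite union is at most the sum of the integrals. -/
theorem setIntegral_biUnion_finset_le {f : E3 → ℝ} (hf : Integrable f) (hf0 : ∀ x, 0 ≤ f x)
    (s : Finset ℕ) (S : ℕ → Set E3) (hS : ∀ i ∈ s, MeasurableSet (S i)) :
    ∫ x in ⋃ i ∈ s, S i, f x ≤ ∑ i ∈ s, ∫ x in S i, f x := by
  classical
  have hUm : MeasurableSet (⋃ i ∈ s, S i) := Finset.measurableSet_biUnion s hS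
  rw [← integral_indicator hUm]
  have hsum : ∑ i ∈ s, ∫ x in S i, f x = ∫ x, ∑ i ∈ s, (S i).indicator f x := by
    rw [integral_finsetSum s fun i hi => (hf.indicator (hS i hi))]
    exact Finset.sum_congr rfl fun i hi => (integral_indicator (hS i hi)).symm
  rw [hsum]
  refine integral_mono (hf.indicator hUm) (integrable_finsetSum s fun i hi => hf.indicator (hS i hi)) fun x => ?_
  by_cases hx : x ∈ ⋃ i ∈ s, S i
  · rw [Set.indicator_of_mem hx]
    obtain ⟨i, hi, hxi⟩ := Set.mem_iUnion₂.1 hx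
    have hle : (S i).indicator f x ≤ ∑ j ∈ s, (S j).indicator f x :=
      Finset.single_le_sum (fun j _ => Set.indicator_nonneg (fun y _ => hf0 y) x) hi
    rw [Set.indicator_of_mem hxi] at hle
    exact hle
  · rw [Set.indicator_of_notMem hx]
    exact Finset.sum_nonneg fun j _ => Set.indicator_nonneg (fun y _ => hf0 y) x

/-- **Brick 4b — assembly.**  In the `A`-regular admissible class (brick 1's `θ₀ = κ⋆/4`, `c₀ = κ⋆/(4A₁)`): for all `R, η > 0` some `ε₀ > 0` works
such that, for a `(κ⋆−ε)`-extremal `v` (`ε ≤ ε₀`), ANY number of scales `m`, tolerance constant `K`, candidate good-centre sets `G i` (each centre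
carrying a good ball of radius `r ∈ [4^i, 2·4^i]`, tolerance `K/(i+1)`) and per-scale bounds `∫_{Θ ∩ U_i} ‖curl v‖² ≤ β i` on the thick
enstrophy of the uncovered sets with `Σ_{i<m} β i < c₀·Z`, there is a thick good centre `x₀` with a good ball near it at every scale `i < m`
(the conclusion of `TypicalSelection`). [folklore] -/
theorem typicalSelection_of_uncovered_small :
    ∀ A : ℕ → ℝ, (∀ j, 1 ≤ A j) → ∃ θ₀ c₀ : ℝ, 0 < θ₀ ∧ 0 < c₀ ∧ ∀ (R η : ℝ), 0 < R → 0 < η → ∃ ε₀ : ℝ, 0 < ε₀ ∧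
    ∀ (v : E3 → E3) (M B ε : ℝ), IsAdm v M B → IsReg A v M → 0 < Zen v → 0 < Wpa v → 0 ≤ ε → ε ≤ ε₀ →
      (kStar - ε) * M * Real.sqrt (Zen v) * Real.sqrt (Wpa v) ≤ Jst v →
      ∀ (m : ℕ) (K : ℝ) (G : ℕ → Set E3) (β : ℕ → ℝ),
        (∀ i, i < m → G i ⊆ {c | ∃ r : ℝ, (4 : ℝ) ^ i ≤ r ∧ r ≤ 2 * (4 : ℝ) ^ i ∧ IsGoodBallAt v M (lam v) c r (K / (i + 1))}) →
        (∀ i, i < m → ∫ x in {x | θ₀ * M * (lam v)⁻¹ ≤ ‖curl v x‖} ∩ {y | ∀ c, dist c y < (4 : ℝ) ^ i * lam v / 2 → c ∉ G i},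
          ‖curl v x‖ ^ 2 ≤ β i) →
        (∑ i ∈ Finset.range m, β i) < c₀ * Zen v →
        ∃ x₀ : E3, θ₀ * M * (lam v)⁻¹ ≤ ‖curl v x₀‖ ∧
          (∀ φ : E3 → E3, IsTestAt v M φ → tsupport φ ⊆ Metric.ball x₀ (R * lam v) →
            locGain (kStar * M) (lam v) v φ ≤ η * M ^ 3) ∧
          ∀ i : ℕ, i < m → ∃ (c : E3) (r : ℝ), dist c x₀ ≤ r * lam v / 2 ∧ (4 : ℝ) ^ i ≤ r ∧ r ≤ 2 * (4 : ℝ) ^ i ∧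
            IsGoodBallAt v M (lam v) c r (K / (i + 1)) := by
  intro A hA
  obtain ⟨θ₀, c₀, hθ₀, hc₀, h1⟩ := exists_thickGood_mem A hA
  refine ⟨θ₀, c₀, hθ₀, hc₀, fun R η hR hη => ?_⟩
  obtain ⟨ε₀, hε₀, h1'⟩ := h1 R η hR hη
  refine ⟨ε₀, hε₀, ?_⟩
  intro v M B ε hadm hreg hZ hW hε0 hε hext m K G β hG hβ hsum
  obtain ⟨hv, hdiv, hvM, hvB, h0, h1l, h2⟩ := id hadm
  have hv1 : ContDiff ℝ 1 v := hv.of_le (by norm_cast)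
  have hv2 : ContDiff ℝ 2 v := hv.of_le (by norm_cast)
  -- the thick set and the uncovered sets
  set Θ : Set E3 := {x | θ₀ * M * (lam v)⁻¹ ≤ ‖curl v x‖} with hΘ
  have hΘm : MeasurableSet Θ := (isClosed_le continuous_const (continuous_curl hv1).norm).measurableSet
  set U : ℕ → Set E3 := fun i => {y | ∀ c, dist c y < (4 : ℝ) ^ i * lam v / 2 → c ∉ G i} with hU
  have hUm : ∀ i, MeasurableSet (U i) := fun i => (isClosed_uncovered (G i) _).measurableSet
  -- the test set `Y = (Θ ∩ ⋃_{i<m} U i)ᶜ`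
  set X : Set E3 := ⋃ i ∈ Finset.range m, (Θ ∩ U i) with hX
  have hXm : MeasurableSet X := Finset.measurableSet_biUnion _ fun i _ => hΘm.inter (hUm i)
  have hω2 : Integrable (fun x => ‖curl v x‖ ^ 2) := (integrable_norm_curl_sq hv2 h1l).1
  have hXle : ∫ x in X, ‖curl v x‖ ^ 2 ≤ ∑ i ∈ Finset.range m, β i := by
    refine (setIntegral_biUnion_finset_le hω2 (fun x => sq_nonneg _) (Finset.range m) (fun i => Θ ∩ U i)
      (fun i _ => hΘm.inter (hUm i))).trans ?_
    exact Finset.sum_le_sum fun i hi => hβ i (Finset.mem_range.1 hi)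
  have hcompl : (∫ x in X, ‖curl v x‖ ^ 2) + ∫ x in Xᶜ, ‖curl v x‖ ^ 2 = Zen v := by
    unfold Zen; exact integral_add_compl hXm hω2
  have hYlarge : (1 - c₀) * Zen v < ∫ x in Xᶜ, ‖curl v x‖ ^ 2 := by nlinarith [hXle, hcompl, hsum]
  -- brick 1: a thick good centre in `Y = Xᶜ`
  obtain ⟨x₀, hx₀Y, hthick, hgood⟩ := h1' v M B ε hadm hreg hZ hW hε0 hε hext Xᶜ hXm.compl hYlarge
  refine ⟨x₀, hthick, hgood, fun i hi => ?_⟩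
  -- `x₀ ∈ Θ`, hence `x₀ ∉ U i`: some good centre within `4^i λ/2`
  have hx₀Θ : x₀ ∈ Θ := hthick
  have hx₀U : x₀ ∉ U i := by
    intro hxU
    exact hx₀Y (Set.mem_iUnion₂.2 ⟨i, Finset.mem_range.2 hi, hx₀Θ, hxU⟩)
  have hex : ∃ c, dist c x₀ < (4 : ℝ) ^ i * lam v / 2 ∧ c ∈ G i := by
    by_contra hne
    push Not at hne
    exact hx₀U fun c hc hcG => hne c hc hcG
  obtain ⟨c, hcd, hcG⟩ := hex
  obtain ⟨r, hr1, hr2, hgoodball⟩ := hG i hi hcG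
  refine ⟨c, r, ?_, hr1, hr2, hgoodball⟩
  have hl : 0 ≤ lam v := Real.sqrt_nonneg _
  have : (4 : ℝ) ^ i * lam v / 2 ≤ r * lam v / 2 := by
    have := mul_le_mul_of_nonneg_right hr1 hl
    linarith
  linarith

end Summit.NavierStokesRegularity.NavierStokesRegularity.Theorems.NearExtremalTransiencePerFlow.TwoThirds

end
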